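import Mathlib
import HarnessLib
import Summits.Ventures.LatticeQCDFlow.Scoring.ReversibleKernelTauIntFloor
import Summits.Ventures.LatticeQCDFlow.Scoring.GeometricEnvelopeBlockSumSharp

/-!
# A REVERSIBLE sampler with ANY geometric sup-norm envelope rate `ρ` has `|C(t)| ≤ ρᵗ · Var_π f` for
# every lag and every bounded observable (constant ONE), hence `τ_int ≤ (1+ρ)/(2(1−ρ))`; every even-lag
# ratio is a certified floor `C(2m+2)/C(2m) ≤ ρ²`; odd lags are dominated, `C(2m+1)² ≤ C(2m) C(2m+2)`

HONEST FRAMING: exact (Metropolis-corrected) sampling algorithms for lattice gauge theory;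
figures of merit are autocorrelation/cost numbers at stated couplings and volumes; no
continuum-physics claim.

Venture `LatticeQCDFlow` (cell pub-lqcd), topic `Scoring`; FANOUT row 8 (`s0-cpn-nemc`, GEN-23).
NEW WORK of the cell, not a published result; no definition is introduced; nothing is cited as a
fact.  Row 2's `Exactness/ReversibleTwoStep` proved, for its admissible-class packaging of a
reversible operator, that the EVEN lags are nonnegative, nonincreasing, convex and log-convex.  In the
(bdd)/(symm)/(contr) packaging of `Exactness/ReversibleTauIntFloor` (weight `w > 0`, `K`
bounded-measurable-preserving, `L²(w)`-symmetric, contracting; `C(n) = ∫ g (Kⁿ g) w dμ`) the two-time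
form `C(a+b) = ⟨Kᵃ g, Kᵇ g⟩_w` and Cauchy–Schwarz give in three lines each (restated here so that the
kernel instances below are one `simpa`): `C(2m+2) ≤ C(2m)`, the log-convexity
`C(2m+2)² ≤ C(2m) C(2m+4)`, and — NEW — the ODD-LAG DOMINATION `C(2m+1)² ≤ C(2m) C(2m+2)`; hence the
even-lag ratios `r_m = C(2m+2)/C(2m)` are NONDECREASING in `m` (they increase to the squared spectral
radius of `K` on the cyclic subspace of `g` — named, not used).  Consequently, for a `π`-reversible
Markov kernel with ANY geometric sup-norm envelope `|(kop κ)^[t] u − πu| ≤ 2 C_u A ρ^t` (any `ρ`) and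
any bounded observable `f` (`C(t) = autocov κ π f̄ t`, `f̄ = f − πf`): **`C(2m+2) ≤ ρ² C(2m)` for every
`m`** — if some ratio exceeded `ρ²`, monotonicity of the ratios would make `C(2m+2k)` decay slower than
`ρ^{2k}`, against `|C(t)| ≤ 8 C² A ρ^t`; iterating and dominating the odd lags, **`|C(t)| ≤ ρᵗ C(0)` for
every `t`** — the `L²` envelope with constant ONE (`τ_int ≤ (1+ρ)/(2(1−ρ))` follows at once).
Reading for the cell (value-free): along a reversible exact sampler, every measured even-lag ratio `√(C(2m+2)/C(2m))` of any observable is a LOWER BOUND for every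
admissible relaxation rate `ρ` of the kernel (the floors improve with `m`), and an odd-lag
autocovariance never exceeds the geometric mean of its even neighbours — two shape constraints an
honest autocorrelation analysis of HMC / flow-sampler / heat-bath output can enforce.  Printed
counterparts NAMED ONLY: the spectral-measure representation `C(n) = ∫ λⁿ dE_g(λ)` of reversible
chains and its consequences (Geyer 1992 §3; Sokal 1996 lecture notes §2; Madras–Slade §9.2) — nothing is
cited as a fact.

## Content

Abstract (`(X, μ)`, `w > 0` integrable, `K` with (bdd), (symm), (contr); `g` bounded measurable):
* `op_even_succ_le` — `C(2m+2) ≤ C(2m)`; `op_even_logConvex` — `C(2m+2)² ≤ C(2m) C(2m+4)` (row 2's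
  facts in this packaging); **`op_odd_sq_le`** — `C(2m+1)² ≤ C(2m) C(2m+2)`;
* `op_even_ratio_mono` — `0 < C(2m) → 0 < C(2m+2) → C(2m+2)/C(2m) ≤ C(2m+4)/C(2m+2)`.
Kernel level (`κ` Markov, `π`-reversible probability law, `g` bounded measurable, `C = autocov κ π g`):
* `autocov_even_succ_le_of_isReversible`, `autocov_odd_sq_le_of_isReversible`,
  `autocov_even_logConvex_of_isReversible`;
* **`autocov_even_succ_le_rate_sq_mul_of_isReversible`** — with the envelope `(A, ρ)` for `f̄ = f − πf`:
  `autocov κ π f̄ (2m+2) ≤ ρ² · autocov κ π f̄ (2m)` for every `m`;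
* **`abs_autocov_le_rate_pow_mul_of_isReversible`** — `|autocov κ π f̄ t| ≤ ρᵗ · Var_π f` for EVERY `t`
  (`ρ ≥ 0`): the autocorrelation function of a reversible sampler is below `ρᵗ` with constant one;
* **`tauInt_le_rate_of_isReversible`** — `Var_π f ≠ 0 ⇒ τ_int(f) ≤ (1+ρ)/(2(1−ρ))` (`Scoring.tauInt`).

NOT CLAIMED: the limit of the ratios (spectral radius) or its attainment; non-reversible kernels;
unbounded observables; any number of ours.
-/

noncomputable section

open MeasureTheory ProbabilityTheory Filter Finset

/-! ### Abstract reversible operators -/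

namespace Summit.Ventures.LatticeQCDFlow.Exactness

section Reversible

variable {X : Type*} [MeasurableSpace X] {μ : Measure X} {w : X → ℝ} {K : (X → ℝ) → (X → ℝ)}

/-- **`C(2m+2) ≤ C(2m)`**: `‖K^{m+1} g‖²_w ≤ ‖Kᵐ g‖²_w` (contraction). -/
theorem op_even_succ_le (hw0 : ∀ x, 0 < w x)
    (hbdd : ∀ ⦃f : X → ℝ⦄ ⦃B : ℝ⦄, Measurable f → (∀ x, |f x| ≤ B) →
      Measurable (K f) ∧ ∀ x, |K f x| ≤ B)
    (hsymm : ∀ ⦃f h : X → ℝ⦄ ⦃Bf Bh : ℝ⦄, Measurable f → Measurable h → (∀ x, |f x| ≤ Bf) →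
      (∀ x, |h x| ≤ Bh) → ∫ x, K f x * h x * w x ∂μ = ∫ x, f x * K h x * w x ∂μ)
    (hcontr : ∀ ⦃f : X → ℝ⦄ ⦃B : ℝ⦄, Measurable f → (∀ x, |f x| ≤ B) →
      ∫ x, K f x ^ 2 * w x ∂μ ≤ ∫ x, f x ^ 2 * w x ∂μ)
    {g : X → ℝ} (hgm : Measurable g) {B : ℝ} (hgb : ∀ x, |g x| ≤ B) (m : ℕ) :
    ∫ x, g x * (K^[2 * m + 2] g) x * w x ∂μ ≤ ∫ x, g x * (K^[2 * m] g) x * w x ∂μ := by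
  have _ := hw0
  obtain ⟨hpm, hpb⟩ := op_iterate_bdd hbdd m hgm hgb
  have e0 : ∫ x, g x * (K^[2 * m] g) x * w x ∂μ = ∫ x, (K^[m] g) x ^ 2 * w x ∂μ := by
    rw [two_mul, ← op_two_time hbdd hsymm hgm hgb m m]
    exact integral_congr_ae (ae_of_all _ fun x => by ring)
  have e2 : ∫ x, g x * (K^[2 * m + 2] g) x * w x ∂μ = ∫ x, (K (K^[m] g)) x ^ 2 * w x ∂μ := by
    rw [show 2 * m + 2 = (m + 1) + (m + 1) by ring, ← op_two_time hbdd hsymm hgm hgb (m + 1) (m + 1),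
      Function.iterate_succ_apply']
    exact integral_congr_ae (ae_of_all _ fun x => by ring)
  rw [e0, e2]
  exact hcontr hpm hpb

/-- **Odd lags are dominated**: `C(2m+1)² ≤ C(2m) C(2m+2)` (Cauchy–Schwarz on `⟨Kᵐ g, K^{m+1} g⟩_w`). -/
theorem op_odd_sq_le (hw0 : ∀ x, 0 < w x) (hwm : Measurable w) (hwi : Integrable w μ)
    (hbdd : ∀ ⦃f : X → ℝ⦄ ⦃B : ℝ⦄, Measurable f → (∀ x, |f x| ≤ B) →
      Measurable (K f) ∧ ∀ x, |K f x| ≤ B)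
    (hsymm : ∀ ⦃f h : X → ℝ⦄ ⦃Bf Bh : ℝ⦄, Measurable f → Measurable h → (∀ x, |f x| ≤ Bf) →
      (∀ x, |h x| ≤ Bh) → ∫ x, K f x * h x * w x ∂μ = ∫ x, f x * K h x * w x ∂μ)
    {g : X → ℝ} (hgm : Measurable g) {B : ℝ} (hgb : ∀ x, |g x| ≤ B) (m : ℕ) :
    (∫ x, g x * (K^[2 * m + 1] g) x * w x ∂μ) ^ 2
      ≤ (∫ x, g x * (K^[2 * m] g) x * w x ∂μ) * ∫ x, g x * (K^[2 * m + 2] g) x * w x ∂μ := by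
  obtain ⟨hpm, hpb⟩ := op_iterate_bdd hbdd m hgm hgb
  obtain ⟨hqm, hqb⟩ := op_iterate_bdd hbdd (m + 1) hgm hgb
  have e0 : ∫ x, g x * (K^[2 * m] g) x * w x ∂μ = ∫ x, (K^[m] g) x ^ 2 * w x ∂μ := by
    rw [two_mul, ← op_two_time hbdd hsymm hgm hgb m m]
    exact integral_congr_ae (ae_of_all _ fun x => by ring)
  have e1 : ∫ x, g x * (K^[2 * m + 1] g) x * w x ∂μ = ∫ x, (K^[m] g) x * (K^[m + 1] g) x * w x ∂μ := by
    rw [show 2 * m + 1 = m + (m + 1) by ring, ← op_two_time hbdd hsymm hgm hgb m (m + 1)]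
  have e2 : ∫ x, g x * (K^[2 * m + 2] g) x * w x ∂μ = ∫ x, (K^[m + 1] g) x ^ 2 * w x ∂μ := by
    rw [show 2 * m + 2 = (m + 1) + (m + 1) by ring, ← op_two_time hbdd hsymm hgm hgb (m + 1) (m + 1)]
    exact integral_congr_ae (ae_of_all _ fun x => by ring)
  rw [e0, e1, e2]
  exact sq_integral_mul_mul_le hw0 hwm hwi hpm hqm hpb hqb

/-- **LOG-CONVEXITY of the even lags**: `C(2m+2)² ≤ C(2m) C(2m+4)` (Cauchy–Schwarz on
`C(2m+2) = ⟨Kᵐ g, K^{m+2} g⟩_w`). -/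
theorem op_even_logConvex (hw0 : ∀ x, 0 < w x) (hwm : Measurable w) (hwi : Integrable w μ)
    (hbdd : ∀ ⦃f : X → ℝ⦄ ⦃B : ℝ⦄, Measurable f → (∀ x, |f x| ≤ B) →
      Measurable (K f) ∧ ∀ x, |K f x| ≤ B)
    (hsymm : ∀ ⦃f h : X → ℝ⦄ ⦃Bf Bh : ℝ⦄, Measurable f → Measurable h → (∀ x, |f x| ≤ Bf) →
      (∀ x, |h x| ≤ Bh) → ∫ x, K f x * h x * w x ∂μ = ∫ x, f x * K h x * w x ∂μ)
    {g : X → ℝ} (hgm : Measurable g) {B : ℝ} (hgb : ∀ x, |g x| ≤ B) (m : ℕ) :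
    (∫ x, g x * (K^[2 * m + 2] g) x * w x ∂μ) ^ 2
      ≤ (∫ x, g x * (K^[2 * m] g) x * w x ∂μ) * ∫ x, g x * (K^[2 * m + 4] g) x * w x ∂μ := by
  obtain ⟨hpm, hpb⟩ := op_iterate_bdd hbdd m hgm hgb
  obtain ⟨hrm, hrb⟩ := op_iterate_bdd hbdd (m + 2) hgm hgb
  have e0 : ∫ x, g x * (K^[2 * m] g) x * w x ∂μ = ∫ x, (K^[m] g) x ^ 2 * w x ∂μ := by
    rw [two_mul, ← op_two_time hbdd hsymm hgm hgb m m]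
    exact integral_congr_ae (ae_of_all _ fun x => by ring)
  have e2 : ∫ x, g x * (K^[2 * m + 2] g) x * w x ∂μ = ∫ x, (K^[m] g) x * (K^[m + 2] g) x * w x ∂μ := by
    rw [show 2 * m + 2 = m + (m + 2) by ring, ← op_two_time hbdd hsymm hgm hgb m (m + 2)]
  have e4 : ∫ x, g x * (K^[2 * m + 4] g) x * w x ∂μ = ∫ x, (K^[m + 2] g) x ^ 2 * w x ∂μ := by
    rw [show 2 * m + 4 = (m + 2) + (m + 2) by ring, ← op_two_time hbdd hsymm hgm hgb (m + 2) (m + 2)]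
    exact integral_congr_ae (ae_of_all _ fun x => by ring)
  rw [e0, e2, e4]
  exact sq_integral_mul_mul_le hw0 hwm hwi hpm hrm hpb hrb

/-- **The even-lag ratios are nondecreasing**: `C(2m), C(2m+2) > 0 ⇒ C(2m+2)/C(2m) ≤ C(2m+4)/C(2m+2)`. -/
theorem op_even_ratio_mono (hw0 : ∀ x, 0 < w x) (hwm : Measurable w) (hwi : Integrable w μ)
    (hbdd : ∀ ⦃f : X → ℝ⦄ ⦃B : ℝ⦄, Measurable f → (∀ x, |f x| ≤ B) →
      Measurable (K f) ∧ ∀ x, |K f x| ≤ B)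
    (hsymm : ∀ ⦃f h : X → ℝ⦄ ⦃Bf Bh : ℝ⦄, Measurable f → Measurable h → (∀ x, |f x| ≤ Bf) →
      (∀ x, |h x| ≤ Bh) → ∫ x, K f x * h x * w x ∂μ = ∫ x, f x * K h x * w x ∂μ)
    {g : X → ℝ} (hgm : Measurable g) {B : ℝ} (hgb : ∀ x, |g x| ≤ B) (m : ℕ)
    (h0 : 0 < ∫ x, g x * (K^[2 * m] g) x * w x ∂μ) (h2 : 0 < ∫ x, g x * (K^[2 * m + 2] g) x * w x ∂μ) :
    (∫ x, g x * (K^[2 * m + 2] g) x * w x ∂μ) / (∫ x, g x * (K^[2 * m] g) x * w x ∂μ)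
      ≤ (∫ x, g x * (K^[2 * m + 4] g) x * w x ∂μ) / (∫ x, g x * (K^[2 * m + 2] g) x * w x ∂μ) := by
  rw [div_le_div_iff₀ h0 h2]
  have h := op_even_logConvex hw0 hwm hwi hbdd hsymm hgm hgb m
  nlinarith [h]

end Reversible

end Summit.Ventures.LatticeQCDFlow.Exactness

/-! ### Kernel level -/

namespace Summit.Ventures.LatticeQCDFlow.Scoring

open Summit.Ventures.LatticeQCDFlow.Exactness

variable {Ω : Type*} [MeasurableSpace Ω]

section Kernel

variable {κ : Kernel Ω Ω} [IsMarkovKernel κ] {π : Measure Ω} [IsProbabilityMeasure π] {A ρ : ℝ}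

/-- `C(2m+2) ≤ C(2m)` for every `π`-reversible kernel and bounded measurable `g`. -/
theorem autocov_even_succ_le_of_isReversible (hrev : Kernel.IsReversible κ π) {g : Ω → ℝ}
    (hg : Measurable g) {B : ℝ} (hB : ∀ x, |g x| ≤ B) (m : ℕ) :
    autocov κ π g (2 * m + 2) ≤ autocov κ π g (2 * m) := by
  have h := op_even_succ_le (μ := π) (w := fun _ : Ω => (1 : ℝ)) (K := kop κ)
    (fun _ => one_pos) kop_opBdd (kop_opSymm hrev) (kop_opContr hrev.invariant) hg hB m
  simpa only [integral_mul_iterate_kop_mul_one] using h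

/-- `C(2m+1)² ≤ C(2m) C(2m+2)` for every `π`-reversible kernel and bounded measurable `g`. -/
theorem autocov_odd_sq_le_of_isReversible (hrev : Kernel.IsReversible κ π) {g : Ω → ℝ}
    (hg : Measurable g) {B : ℝ} (hB : ∀ x, |g x| ≤ B) (m : ℕ) :
    autocov κ π g (2 * m + 1) ^ 2 ≤ autocov κ π g (2 * m) * autocov κ π g (2 * m + 2) := by
  have h := op_odd_sq_le (μ := π) (w := fun _ : Ω => (1 : ℝ)) (K := kop κ)
    (fun _ => one_pos) measurable_const (integrable_const _) kop_opBdd (kop_opSymm hrev) hg hB m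
  simpa only [integral_mul_iterate_kop_mul_one] using h

/-- `C(2m+2)² ≤ C(2m) C(2m+4)` (log-convex even lags) for every `π`-reversible kernel. -/
theorem autocov_even_logConvex_of_isReversible (hrev : Kernel.IsReversible κ π) {g : Ω → ℝ}
    (hg : Measurable g) {B : ℝ} (hB : ∀ x, |g x| ≤ B) (m : ℕ) :
    autocov κ π g (2 * m + 2) ^ 2 ≤ autocov κ π g (2 * m) * autocov κ π g (2 * m + 4) := by
  have h := op_even_logConvex (μ := π) (w := fun _ : Ω => (1 : ℝ)) (K := kop κ)
    (fun _ => one_pos) measurable_const (integrable_const _) kop_opBdd (kop_opSymm hrev) hg hB m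
  simpa only [integral_mul_iterate_kop_mul_one] using h

/-- **EVERY EVEN-LAG RATIO IS BELOW THE SQUARED ENVELOPE RATE.**  `κ` `π`-reversible with a
geometric sup-norm envelope `(A, ρ)` (ANY real `ρ`; no sign or size condition is needed), `|f| ≤ C`
measurable, `f̄ = f − πf`, `C(t) = autocov κ π f̄ t`: for every `m`, `C(2m+2) ≤ ρ² C(2m)`. -/
theorem autocov_even_succ_le_rate_sq_mul_of_isReversible (hrev : Kernel.IsReversible κ π)
    (henv : ∀ (g : Ω → ℝ), Measurable g → ∀ (Cg : ℝ), (∀ x, |g x| ≤ Cg) →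
      ∀ (t : ℕ) (x : Ω), |(kop κ)^[t] g x - ∫ y, g y ∂π| ≤ 2 * Cg * (A * ρ ^ t))
    {f : Ω → ℝ} (hf : Measurable f) {C : ℝ} (hC : ∀ x, |f x| ≤ C) (m : ℕ) :
    autocov κ π (fun y => f y - ∫ z, f z ∂π) (2 * m + 2)
      ≤ ρ ^ 2 * autocov κ π (fun y => f y - ∫ z, f z ∂π) (2 * m) := by
  obtain ⟨hfb, hCfb, -⟩ := centred_observable_bounds π hf hC
  set c : ℕ → ℝ := fun t => autocov κ π (fun y => f y - ∫ z, f z ∂π) t with hc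
  have henvc : ∀ t, |c t| ≤ 8 * C ^ 2 * A * ρ ^ t := fun t =>
    abs_autocov_le_of_geometricEnvelope henv hf hC t
  have hnn : ∀ j, 0 ≤ c (2 * j) := fun j => autocov_even_nonneg_of_isReversible hrev hfb hCfb j
  have hlc : ∀ j, c (2 * j + 2) ^ 2 ≤ c (2 * j) * c (2 * j + 4) := fun j =>
    autocov_even_logConvex_of_isReversible hrev hfb hCfb j
  show c (2 * m + 2) ≤ ρ ^ 2 * c (2 * m)
  rcases le_or_gt (c (2 * m + 2)) (ρ ^ 2 * c (2 * m)) with hle | hlt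
  · exact hle
  exfalso
  -- then `c(2m) > 0`, `c(2m+2) > 0` and the ratio `r = c(2m+2)/c(2m) > ρ²`
  have h2pos : 0 < c (2 * m + 2) := by
    have : 0 ≤ ρ ^ 2 * c (2 * m) := mul_nonneg (sq_nonneg _) (hnn m)
    linarith
  have h0pos : 0 < c (2 * m) := by
    rcases (hnn m).eq_or_lt with h | h
    · have := hlc m
      rw [← h, zero_mul] at this
      nlinarith
    · exact h
  set r := c (2 * m + 2) / c (2 * m) with hr
  have hrρ : ρ ^ 2 < r := by rw [hr, lt_div_iff₀ h0pos]; linarith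
  have hr0 : 0 < r := div_pos h2pos h0pos
  -- invariant along the even lags `L_k = 2m + 2k`: positivity and the ratio inequality
  -- `c(2m+2) · c(L_k) ≤ c(2m) · c(L_k + 2)` (log-convexity makes the ratios nondecreasing)
  have hinv : ∀ k : ℕ, 0 < c (2 * m + 2 * k) ∧
      c (2 * m + 2) * c (2 * m + 2 * k) ≤ c (2 * m) * c (2 * m + 2 * k + 2) := by
    intro k
    induction k with
    | zero =>
      refine ⟨by simpa using h0pos, ?_⟩
      simp only [Nat.mul_zero, Nat.add_zero]
      rw [mul_comm]
    | succ k ih =>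
      obtain ⟨ihpos, ihrat⟩ := ih
      have e : 2 * m + 2 * (k + 1) = 2 * m + 2 * k + 2 := by ring
      rw [e]
      -- positivity of `c(L+2)` from the ratio inequality
      have hpos2 : 0 < c (2 * m + 2 * k + 2) := by
        have h1 : 0 < c (2 * m + 2) * c (2 * m + 2 * k) := mul_pos h2pos ihpos
        have h2 : 0 < c (2 * m) * c (2 * m + 2 * k + 2) := lt_of_lt_of_le h1 ihrat
        exact pos_of_mul_pos_right h2 h0pos.le
      refine ⟨hpos2, ?_⟩
      -- log-convexity at `L = 2m+2k`: `c(L+2)² ≤ c(L) c(L+4)`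
      have hlcL := hlc (m + k)
      have e5 : 2 * (m + k) = 2 * m + 2 * k := by ring
      have e6 : 2 * (m + k) + 2 = 2 * m + 2 * k + 2 := by ring
      have e7 : 2 * (m + k) + 4 = 2 * m + 2 * k + 2 + 2 := by ring
      rw [e6, e7, e5] at hlcL
      -- `c(L) · [c(2m+2) c(L+2)] ≤ c(2m) c(L+2)² ≤ c(L) · [c(2m) c(L+4)]`
      have s1 : c (2 * m + 2 * k) * (c (2 * m + 2) * c (2 * m + 2 * k + 2))
          ≤ c (2 * m) * c (2 * m + 2 * k + 2) * c (2 * m + 2 * k + 2) := by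
        have := mul_le_mul_of_nonneg_right ihrat hpos2.le
        linarith [this]
      have s2 : c (2 * m) * c (2 * m + 2 * k + 2) * c (2 * m + 2 * k + 2)
          ≤ c (2 * m + 2 * k) * (c (2 * m) * c (2 * m + 2 * k + 2 + 2)) := by
        have := mul_le_mul_of_nonneg_left hlcL h0pos.le
        nlinarith [this]
      exact le_of_mul_le_mul_left (s1.trans s2) ihpos
  -- growth: `c(2m) r^k ≤ c(2m + 2k)`
  have hgrow : ∀ k : ℕ, c (2 * m) * r ^ k ≤ c (2 * m + 2 * k) := by
    intro k
    induction k with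
    | zero => simp
    | succ k ih =>
      obtain ⟨ihpos, ihrat⟩ := hinv k
      have e : 2 * m + 2 * (k + 1) = 2 * m + 2 * k + 2 := by ring
      rw [e, pow_succ]
      -- `c(L) · r ≤ c(L+2)` from the ratio inequality
      have hstep : c (2 * m + 2 * k) * r ≤ c (2 * m + 2 * k + 2) := by
        rw [hr, mul_div_assoc', div_le_iff₀ h0pos]
        linarith [ihrat]
      calc c (2 * m) * (r ^ k * r) = (c (2 * m) * r ^ k) * r := by ring
        _ ≤ c (2 * m + 2 * k) * r := mul_le_mul_of_nonneg_right ih hr0.le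
        _ ≤ c (2 * m + 2 * k + 2) := hstep
  -- envelope: `c(2m) r^k ≤ 8 C² A ρ^{2m} (ρ²)^k` for every `k`
  have hbound : ∀ k : ℕ, c (2 * m) * r ^ k ≤ 8 * C ^ 2 * A * ρ ^ (2 * m) * (ρ ^ 2) ^ k := by
    intro k
    have h1 := hgrow k
    have h2 := (le_abs_self _).trans (henvc (2 * m + 2 * k))
    rw [show ρ ^ (2 * m + 2 * k) = ρ ^ (2 * m) * (ρ ^ 2) ^ k by rw [pow_add, ← pow_mul]] at h2
    linarith
  rcases (sq_nonneg ρ).eq_or_lt with hρz | hρpos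
  · -- `ρ = 0`: `c(2m) r ≤ 0` at `k = 1`, but `c(2m) r = c(2m+2) > 0`
    have h := hbound 1
    rw [← hρz] at h
    simp only [pow_one, mul_zero] at h
    have e : c (2 * m) * r = c (2 * m + 2) := by rw [hr]; field_simp
    linarith
  · -- `(r/ρ²)^k → ∞` while bounded
    have hq : 1 < r / ρ ^ 2 := (one_lt_div hρpos).2 hrρ
    have htend := tendsto_pow_atTop_atTop_of_one_lt hq
    set M := 8 * C ^ 2 * A * ρ ^ (2 * m) with hM
    have hbdd' : ∀ k : ℕ, (r / ρ ^ 2) ^ k ≤ M / c (2 * m) := by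
      intro k
      rw [div_pow, div_le_div_iff₀ (pow_pos hρpos k) h0pos]
      have := hbound k
      linarith [mul_comm (c (2 * m)) (r ^ k), mul_comm M ((ρ ^ 2) ^ k)]
    obtain ⟨k, hk⟩ := (htend.eventually (eventually_gt_atTop (M / c (2 * m)))).exists
    exact absurd (hbdd' k) (not_le.2 hk)

/-- **`|C(t)| ≤ ρᵗ · C(0)` FOR EVERY LAG**: for a `π`-reversible kernel with a geometric sup-norm
envelope of rate `ρ ≥ 0` and every `|f| ≤ C` measurable (`C(t) = autocov κ π f̄ t`, `C(0) = Var_π f`), the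
autocorrelation function is dominated by `ρᵗ` with constant ONE (even lags by the ratio theorem,
odd lags by domination) — the `L²` form of the envelope, free of the constant `A`. -/
theorem abs_autocov_le_rate_pow_mul_of_isReversible (hrev : Kernel.IsReversible κ π)
    (henv : ∀ (g : Ω → ℝ), Measurable g → ∀ (Cg : ℝ), (∀ x, |g x| ≤ Cg) →
      ∀ (t : ℕ) (x : Ω), |(kop κ)^[t] g x - ∫ y, g y ∂π| ≤ 2 * Cg * (A * ρ ^ t))
    (hρ0 : 0 ≤ ρ) {f : Ω → ℝ} (hf : Measurable f) {C : ℝ} (hC : ∀ x, |f x| ≤ C) (t : ℕ) :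
    |autocov κ π (fun y => f y - ∫ z, f z ∂π) t|
      ≤ ρ ^ t * autocov κ π (fun y => f y - ∫ z, f z ∂π) 0 := by
  obtain ⟨hfb, hCfb, -⟩ := centred_observable_bounds π hf hC
  set c : ℕ → ℝ := fun t => autocov κ π (fun y => f y - ∫ z, f z ∂π) t with hc
  have hnn : ∀ j, 0 ≤ c (2 * j) := fun j => autocov_even_nonneg_of_isReversible hrev hfb hCfb j
  have hstep : ∀ j, c (2 * j + 2) ≤ ρ ^ 2 * c (2 * j) := fun j =>
    autocov_even_succ_le_rate_sq_mul_of_isReversible hrev henv hf hC j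
  -- even lags: `c(2m) ≤ ρ^{2m} c(0)`
  have heven : ∀ m : ℕ, c (2 * m) ≤ ρ ^ (2 * m) * c 0 := by
    intro m
    induction m with
    | zero => simp
    | succ m ih =>
      have e : 2 * (m + 1) = 2 * m + 2 := by ring
      rw [e, pow_add]
      calc c (2 * m + 2) ≤ ρ ^ 2 * c (2 * m) := hstep m
        _ ≤ ρ ^ 2 * (ρ ^ (2 * m) * c 0) := mul_le_mul_of_nonneg_left ih (sq_nonneg _)
        _ = ρ ^ (2 * m) * ρ ^ 2 * c 0 := by ring
  show |c t| ≤ ρ ^ t * c 0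
  obtain ⟨m, rfl | rfl⟩ := Nat.even_or_odd' t
  · rw [abs_of_nonneg (hnn m)]
    exact heven m
  · -- odd lags: `c(2m+1)² ≤ c(2m) c(2m+2) ≤ ρ² c(2m)²`
    have hsq : c (2 * m + 1) ^ 2 ≤ (ρ * c (2 * m)) ^ 2 := by
      calc c (2 * m + 1) ^ 2 ≤ c (2 * m) * c (2 * m + 2) :=
            autocov_odd_sq_le_of_isReversible hrev hfb hCfb m
        _ ≤ c (2 * m) * (ρ ^ 2 * c (2 * m)) := mul_le_mul_of_nonneg_left (hstep m) (hnn m)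
        _ = (ρ * c (2 * m)) ^ 2 := by ring
    have habs := abs_le_of_sq_le_sq' hsq (mul_nonneg hρ0 (hnn m))
    calc |c (2 * m + 1)| ≤ ρ * c (2 * m) := abs_le.2 habs
      _ ≤ ρ * (ρ ^ (2 * m) * c 0) := mul_le_mul_of_nonneg_left (heven m) hρ0
      _ = ρ ^ (2 * m + 1) * c 0 := by ring

/-- **THE `τ_int` CEILING OF A REVERSIBLE SAMPLER FROM ITS RATE ALONE**: `κ` `π`-reversible with a
geometric sup-norm envelope of rate `0 ≤ ρ < 1`, `|f| ≤ C` measurable with `Var_π f ≠ 0`; then the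
autocorrelation series is absolutely summable and `τ_int(f) ≤ (1 + ρ)/(2(1 − ρ))` on the tree's
`Scoring.tauInt` — compare the generic `Scoring/DoeblinAutocorrelation.tauInt_le_of_doeblin`
(`1/ε − ½` for a one-step Doeblin constant `ε`; here any Doeblin POWER's rate, no envelope constant). -/
theorem tauInt_le_rate_of_isReversible (hrev : Kernel.IsReversible κ π)
    (henv : ∀ (g : Ω → ℝ), Measurable g → ∀ (Cg : ℝ), (∀ x, |g x| ≤ Cg) →
      ∀ (t : ℕ) (x : Ω), |(kop κ)^[t] g x - ∫ y, g y ∂π| ≤ 2 * Cg * (A * ρ ^ t))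
    (hρ0 : 0 ≤ ρ) (hρ1 : ρ < 1) {f : Ω → ℝ} (hf : Measurable f) {C : ℝ} (hC : ∀ x, |f x| ≤ C)
    (hvar : autocov κ π (fun y => f y - ∫ z, f z ∂π) 0 ≠ 0) :
    tauInt (fun t => autocov κ π (fun y => f y - ∫ z, f z ∂π) t
        / autocov κ π (fun y => f y - ∫ z, f z ∂π) 0) ≤ (1 + ρ) / (2 * (1 - ρ)) := by
  obtain ⟨hfb, hCfb, -⟩ := centred_observable_bounds π hf hC
  set c : ℕ → ℝ := fun t => autocov κ π (fun y => f y - ∫ z, f z ∂π) t with hc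
  have hc0 : 0 < c 0 := by
    rcases (autocov_even_nonneg_of_isReversible hrev hfb hCfb 0).eq_or_lt with h | h
    · exact absurd h.symm hvar
    · simpa using h
  have hacf : ∀ t, |c t / c 0| ≤ ρ ^ t := fun t => by
    rw [abs_div, abs_of_pos hc0, div_le_iff₀ hc0]
    exact abs_autocov_le_rate_pow_mul_of_isReversible hrev henv hρ0 hf hC t
  have habs : |ρ| < 1 := by rw [abs_of_nonneg hρ0]; exact hρ1
  have hgeo := hasSum_geometric_succ habs
  have hsum : Summable fun t : ℕ => c (t + 1) / c 0 :=
    Summable.of_norm_bounded hgeo.summable fun t => by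
      rw [Real.norm_eq_abs]; exact hacf (t + 1)
  have hle : ∑' t : ℕ, c (t + 1) / c 0 ≤ ρ / (1 - ρ) := by
    rw [← hgeo.tsum_eq]
    exact Summable.tsum_le_tsum (fun t => (le_abs_self _).trans (hacf (t + 1))) hsum hgeo.summable
  show tauInt (fun t => c t / c 0) ≤ (1 + ρ) / (2 * (1 - ρ))
  unfold tauInt
  have h1ρ : 0 < 1 - ρ := sub_pos.2 hρ1
  have e : (1 + ρ) / (2 * (1 - ρ)) = 1 / 2 + ρ / (1 - ρ) := by field_simp; ring
  rw [e]
  linarith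

end Kernel

end Summit.Ventures.LatticeQCDFlow.Scoring

end
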